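import Literature.IUT.HodgeArakelov.BadPlaceSettingOfDoubleUnderline
import Literature.IUT.HodgeArakelov.EtaleThetaDataOfSettingCor218i
import HarnessLib

/-!
# [IUTchII] Prop. 2.1 at the [EtTh] model: well-definedness modulo [EtTh] Cor. 2.18 (i) BY NAME (composition)

S. Mochizuki, *Inter-universal Teichmüller theory II*, kurims manuscript (Dec. 2020) §2, Prop. 2.1 pp. 64–65
(claim key `Mochizuki2012`, DISPUTED, D-0012); [EtTh] Cor. 2.18 (i), Publ. RIMS **45** (2009) PDF p. 56
[cite: MochizukiEtTh2009, Cor 2.18(i) p.56]. Proof-only composition file (abc-iut cell, D-0067 wave 4, seat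
abc-iut-w4-d034; cone of [IUTchIII] Cor. 3.12, DAG node **IUTchII:Prop2.1**; GAP-LEDGER G-w4d010-3): no
definitions; imports unchanged abc-iut-w4-d034's `BadPlaceSettingOfDoubleUnderline` (the model bad-place
setting + `TemperedCoverings.YL_eq_of_piYddCharacteristic`) and abc-iut-w4-d013's
`EtaleThetaDataOfSettingCor218i` (`piYddCharacteristic_of_cor218_i`: the model input (H1) IS the `Π^tp_Ÿ`-conjunct
of abc-iut-L2-t2's named FACT `RigidData.Cor218_i` at abc-iut-L2-t8's instantiation `C.rigidData …`).

* `TemperedCoverings.YL_eq_of_cor218_i` — **[IUTchII] Prop. 2.1 is well defined at the [EtTh] model of the Tate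
  curve MODULO the FACT [EtTh] Cor. 2.18 (i) (`Cor218_i`, taken as a hypothesis BY NAME)**: any two Prop. 2.1
  outputs over the same topological group `P` for `BadPlaceSetting.ofDoubleUnderline …` have the same top row
  `Π^tp_{Ÿ̲_v} ⊆ Π^tp_{Y̲_v} ⊆ P`.

[claim: Mochizuki2012, status: disputed] Nothing here takes a side on [IUTchIII] Cor. 3.12; nothing asserts
[EtTh] Cor. 2.18 (i); typed ≠ proved.
-/

noncomputable section

namespace Literature.IUT.HodgeArakelov

open Literature.AnabelianGeometry.EtaleTheta

namespace BadPlaceSetting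

variable {p : ℕ} [Fact p.Prime] {D : Literature.AnabelianGeometry.EtaleTheta.ThetaSetting p}
  {E : D.EtaleThetaData} {l : ℕ} (C : E.DoubleUnderline l) {N : ℕ+} (μ : D.CyclotomeMod l N)
  (hC : D.Compat) (hS : D.Sec2Hyps) (hl : l.Prime) (hp2 : p ≠ 2) (hpl : p ≠ l)
  (hζ : ∃ ζ : D.K, IsPrimitiveRoot ζ (4 * l))
  {η : (C.thetaEnvData μ hC hS).PiYdd → MuN p N} (hη : η ∈ (C.thetaEnvData μ hC hS).thetaCocycles)

/-- Both anabelian hypotheses `hY`, `hYdd` of `TemperedCoverings.YL_eq_of_characteristic` hold at the model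
bad-place setting MODULO [EtTh] Cor. 2.18 (i) (`RigidData.Cor218_i` for L2-t8's `C.rigidData μ hC hS h15 L`,
a hypothesis BY NAME). [claim: Mochizuki2012, status: disputed] -/
theorem isTopCharacteristic_refY_refYdd_ofDoubleUnderline_of_cor218_i (h15 : D.Prop15iii E hC)
    (L : C.CuspLabels) (R : RigidData.{0} N l) (hR : R = C.rigidData μ hC hS h15 L) (h218i : R.Cor218_i) :
    IsTopCharacteristic (ofDoubleUnderline C μ hC hS hl hp2 hpl hζ hη).PiX
        ((ofDoubleUnderline C μ hC hS hl hp2 hpl hζ hη).refY.comap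
          (ofDoubleUnderline C μ hC hS hl hp2 hpl hζ hη).inclPlain) ∧
      IsTopCharacteristic (ofDoubleUnderline C μ hC hS hl hp2 hpl hζ hη).PiX
        ((ofDoubleUnderline C μ hC hS hl hp2 hpl hζ hη).refYdd.comap
          (ofDoubleUnderline C μ hC hS hl hp2 hpl hζ hη).inclPlain) :=
  isTopCharacteristic_refY_refYdd_ofDoubleUnderline C μ hC hS hl hp2 hpl hζ hη
    (EtaleThetaDataOfSetting.piYddCharacteristic_of_cor218_i C μ hC hS h15 L R hR h218i)

/-- **[IUTchII] Prop. 2.1, well-definedness at the [EtTh] model MODULO [EtTh] Cor. 2.18 (i) BY NAME** ("may be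
reconstructed … from `Π^tp_{X̲̲_v}`", kurims p. 65): for the bad-place setting `BadPlaceSetting.ofDoubleUnderline`
of the Tate curve, any two Prop. 2.1 outputs over the same topological group `P` have the same top row, granted the
named FACT `Cor218_i` for L2-t8's `C.rigidData …` — composition of `TemperedCoverings.YL_eq_of_piYddCharacteristic`
(abc-iut-w4-d034) with `EtaleThetaDataOfSetting.piYddCharacteristic_of_cor218_i` (abc-iut-w4-d013).
[claim: Mochizuki2012, status: disputed] -/
theorem _root_.Literature.IUT.HodgeArakelov.TemperedCoverings.YL_eq_of_cor218_i (h15 : D.Prop15iii E hC)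
    (L : C.CuspLabels) (R : RigidData.{0} N l) (hR : R = C.rigidData μ hC hS h15 L) (h218i : R.Cor218_i)
    {P : TopGroup.{0}} (T₁ T₂ : TemperedCoverings (ofDoubleUnderline C μ hC hS hl hp2 hpl hζ hη) P) :
    T₁.YL = T₂.YL ∧ T₁.YddL = T₂.YddL :=
  TemperedCoverings.YL_eq_of_piYddCharacteristic C μ hC hS hl hp2 hpl hζ hη
    (EtaleThetaDataOfSetting.piYddCharacteristic_of_cor218_i C μ hC hS h15 L R hR h218i) T₁ T₂

end BadPlaceSetting

end Literature.IUT.HodgeArakelov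

end
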